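import Summits.CriticalPhenomena.PercolationContinuityZ3.Theorems.PercLowPointHalfSpaceQuantitativeBGNWallDefs
import HarnessLib

/-!
# `QuantitativeBGN` (stmt-CriticalPhenomena-0913), line `longrange-wall-ghost-bootstrap` — arm volume

Stub `stub_armVolume` of the lead-c5 skeleton of the line `longrange-wall-ghost-bootstrap` (objects
`armH` of `Theorems/QuantitativeBGN/Negative/ArmLowerBound.lean` and `clusterH` of
`Theorems/PercLowPointHalfSpaceQuantitativeBGNWallDefs.lean`): on a LATTICE configuration
`ω ⊆ E(ℤ³)` (only nearest-neighbour pairs open), the half-space one-arm event `arm_H(0, r)` forces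
`|C_H(0)| ≥ r + 1`, where `C_H(0)` is the open cluster of the origin inside `H = {x₀ ≥ 0}`.

Deterministic combinatorics (a discrete intermediate value theorem along an open path):

* `ArmVolume.exists_mem_clusterH_apply_eq`: an open path of `ω` inside `H` from `x` to `v` uses only
  lattice edges (`ω ⊆ E(ℤ³)`), so each step changes the `i`-th coordinate by at most one
  (`DCT16.abs_sub_le_one_of_adj`); by induction on the path (`Relation.ReflTransGen`, the `PathIn`
  form `DCT16.mem_openConnIn_iff_pathIn` of `openConnIn`) every integer level `j` between `x i` and
  `v i` is the `i`-th coordinate of some vertex of the path, and every vertex of the path lies in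
  `C_H(x)` (prefix of the path);
* `ArmVolume.le_encard_of_levels`: a set meeting the `r + 1` level sets `{g = 0}, …, {g = r}` of an
  integer-valued map `g` has at least `r + 1` elements (the chosen representatives are distinct);
* `stub_armVolume`: with `y ∈ C_H(0)`, `|y i| ≥ r`, apply the two facts to `g = ± (· i)`.
-/

namespace Summit.CriticalPhenomena.PercolationContinuityZ3.Theorems

open Literature.Probability.Percolation Literature.Probability.LatticeModels
open Summit.CriticalPhenomena.PercolationContinuityZ3.Theorems.WallGhost
open Summit.CriticalPhenomena.PercolationContinuityZ3.Theorems.QuantitativeBGN.Negative (armH)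

namespace ArmVolume

/-- **Discrete intermediate values along an open lattice path.** If `ω ⊆ E(ℤ³)` and `x ⟷ v` by an
open path of `ω` inside `H = {x₀ ≥ 0}`, then every integer `j` between `x i` and `v i` is the `i`-th
coordinate of some vertex of `C_H(x)`: each step of the path is a lattice edge, changing the `i`-th
coordinate by at most one, and every vertex of the path lies in `C_H(x)`. [folklore] -/
theorem exists_mem_clusterH_apply_eq {ω : BondConfig (Site 3)} (hω : ω ⊆ (zdGraph 3).edgeSet)
    (i : Fin 3) {x v : Site 3} (h : ω ∈ openConnIn {y : Site 3 | 0 ≤ y 0} x v) {j : ℤ}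
    (hj : (x i ≤ j ∧ j ≤ v i) ∨ (v i ≤ j ∧ j ≤ x i)) : ∃ w ∈ clusterH ω x, w i = j := by
  obtain ⟨hx, hr⟩ := DCT16.pathIn_of_mem_openConnIn h
  clear h
  induction hr generalizing j with
  | refl =>
    exact ⟨x, mem_clusterH.2 (DCT16.mem_openConnIn_of_pathIn (PathIn.refl hx)), by omega⟩
  | @tail b c hxb hbc ih =>
    by_cases hjb : (x i ≤ j ∧ j ≤ b i) ∨ (b i ≤ j ∧ j ≤ x i)
    · exact ih hjb
    · have hadj : (zdGraph 3).Adj b c :=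
        (SimpleGraph.mem_edgeSet (zdGraph 3)).1 (hω ((openGraph_adj ω b c).1 hbc.1).1)
      have hstep := abs_le.1 (DCT16.abs_sub_le_one_of_adj hadj i)
      exact ⟨c, mem_clusterH.2 (DCT16.mem_openConnIn_of_pathIn ⟨hx, hxb.tail hbc⟩), by omega⟩

/-- **Counting by levels.** If a set `C` meets each of the `r + 1` level sets `{g = 0}, …, {g = r}`
of an integer-valued map `g`, then `C` has at least `r + 1` elements: representatives of distinct
levels are distinct. [folklore] -/
theorem le_encard_of_levels {α : Type*} {C : Set α} {r : ℕ} (g : α → ℤ)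
    (h : ∀ k : ℕ, k ≤ r → ∃ w ∈ C, g w = k) : ((r + 1 : ℕ) : ℕ∞) ≤ C.encard := by
  choose f hfC hfg using fun k : Fin (r + 1) => h k (Nat.lt_succ_iff.mp k.2)
  have hinj : Function.Injective f := fun a b hab => by
    have h' := congrArg g hab
    rw [hfg, hfg] at h'
    exact Fin.ext (by exact_mod_cast h')
  have hsub : Set.range f ⊆ C := by
    rintro _ ⟨k, rfl⟩
    exact hfC k
  calc ((r + 1 : ℕ) : ℕ∞) = (Set.range f).encard := by
        rw [← Set.image_univ, hinj.injOn.encard_image, Set.encard_univ]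
        simp
    _ ≤ C.encard := Set.encard_le_encard hsub

end ArmVolume

open ArmVolume in
/-- **Arms are voluminous** (stub `stub_armVolume` of the line `longrange-wall-ghost-bootstrap`,
crux `QuantitativeBGN`): on a lattice configuration `ω ⊆ E(ℤ³)`, if the open cluster `C_H(0)` of the
origin inside `H = {x₀ ≥ 0}` reaches sup-distance `r` (`ω ∈ arm_H(0, r)`), then `|C_H(0)| ≥ r + 1`:
an open lattice path from `0` to `y` with `|y i| ≥ r` visits vertices with `i`-th coordinate
`0, ±1, …, ±r` (`ArmVolume.exists_mem_clusterH_apply_eq`), which are `r + 1` distinct vertices of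
`C_H(0)` (`ArmVolume.le_encard_of_levels`). [folklore] -/
theorem stub_armVolume : ∀ ω : BondConfig (Site 3), ω ⊆ (zdGraph 3).edgeSet → ∀ r : ℕ, ω ∈ armH r → ((r + 1 : ℕ) : ℕ∞) ≤ (clusterH ω 0).encard := by
  intro ω hω r hr
  obtain ⟨y, ⟨i, hi⟩, hy⟩ := hr
  have h0i : (0 : Site 3) i = 0 := rfl
  rcases le_abs'.1 hi with hneg | hpos
  · refine le_encard_of_levels (fun w : Site 3 => -w i) fun k hk => ?_
    obtain ⟨w, hw, hwi⟩ := exists_mem_clusterH_apply_eq hω i hy (j := -(k : ℤ)) (by omega)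
    exact ⟨w, hw, by simp only [hwi, neg_neg]⟩
  · refine le_encard_of_levels (fun w : Site 3 => w i) fun k hk => ?_
    exact exists_mem_clusterH_apply_eq hω i hy (by omega)

end Summit.CriticalPhenomena.PercolationContinuityZ3.Theorems
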